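import Summits.BirchSwinnertonDyer.Rank1Residual.Additive.RamifiedSevenGenusTrivialCharacterArtinUnit
import HarnessLib

set_option autoImplicit false

/-!
# `𝒞₇` genus road (crux `EllipticUnitValueSevenOfGZK`, K7r), the (5)-unit programme (SUMMON GENUS-UNIT-A5), File C2b-β (memo S7,
# D963 (i)): THE ELEMENT `V = U·c(U)`, `U = ∏_g (g(θ²·ξ♯))^{t_g}`, `ξ♯ = ∏_h (h ξ)^{y_h}` FED TO THE ENGINE — its integrality,
# its χ-logarithm in closed form, and the EXACT IDENTITY `V = 1` REDUCED to one scalar vanishing per even character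

Cell bsd-cm, seat bsd-cm-k-ty1 g26 (literature-prover); ruled memo `pub/bsd-cm/bsd-cm-k-ty1/g26/G45-typing-memo.md` S7 (c225f82434dc25c5;
pen D963 (i)(ii)(iii), D966 (C)).  For `L ⊂ ℚ̄` normal and finite with `Gal(L/ℚ)` commutative, `Φ`, `c` (`Φ ∘ c = conj ∘ Φ`),
units `θ, ξ ∈ L` (both with integral inverse) and INTEGER exponent functions `t, y : Gal(L/ℚ) → ℤ` (in the road: `θ = θu n`,
`ξ = ξu n`, `y` = the coefficients of `σ_{bₙ}⁻¹·Xₙ`, `t` = `tr_{ℚ(μ₆)/ℚ}(η₁⁻¹)` on the torsion subgroup — the successor's data):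

* §1 `isIntegral_zpow_of_inv`, `isIntegral_aut_of_inv`, `isIntegral_finprod_aut_zpow`(+`_inv`), `finprod_aut_zpow_ne_zero` — units are
  closed under Galois translates, integer powers and the finite products `∏ᶠ h, (h u)^{y h}`.
* §2 ★ `logSum_twistedUnit` — THE CLOSED FORM:
  `S_χ(U·c|_L U) = (Σ_g t_g χ(g)⁻¹)·(1 + χ(c|_L)⁻¹)·(2·S_χ(θ) + (Σ_h y_h χ(h)⁻¹)·S_χ(ξ))` for `U = ∏ᶠ g, (g (θ²·ξ♯))^{t g}`,
  `ξ♯ = ∏ᶠ h, (h ξ)^{y h}` (C2a calculus only).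
* §3 `character_restrictNormal_conj_sq`, `one_add_inv_eq_zero_of_ne_one` — `χ(c|_L) = ±1`, so the factor `1 + χ(c|_L)⁻¹` kills the odd χ;
  ★★ `twistedUnit_eq_one_of_forall_even` — **`U·c|_L(U) = 1` as soon as, for every character χ with `χ(c|_L) = 1`,
  `(Σ_g t_g χ(g)⁻¹)·(2·S_χ(θ) + (Σ_h y_h χ(h)⁻¹)·S_χ(ξ)) = 0`** (C1 ★ engine + §2).  THIS HYPOTHESIS IS EXACTLY WHAT THE SUCCESSOR'S
  C2b MUST PROVE from ★★★′ for the genus exponents `(t, y)` (χ|_G ∉ {η₁, η̄₁} ⇒ first factor `0`; χ|_G ∈ {η₁, η̄₁} ⇒ second factor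
  `0` by the master identity and the `χ(Xₙ)` dictionary); nothing else of S7 remains.

HONEST LABEL: bookkeeping; no definition, no named fact, no instance; nothing closes; stmt-BirchSwinnertonDyer-19945 OPEN; K1ᵘ NOT proved
(the vanishing hypothesis of ★★ for the genus exponents, and File E, are ahead); no summit statement is proved by this seat.

## References
* L. C. Washington, *Introduction to Cyclotomic Fields* (1997) §8.3, Lemma 1.6 [Washington1997]; S. Lang, *Cyclotomic Fields I–II*
  (1990) Ch. 3 §5 (PDF p. 71) [Lang1990]; T. Tsuji, J. Number Theory 78 (1999) §6 [Tsuji1999].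
* Tree: C1 (p790011), C2a (p790156), C2b-α, B2b (`complexConjugation_mul_self`, `coe_restrictNormal_apply`) (this seat).
-/

noncomputable section

open scoped NumberField ComplexConjugate
open Field

namespace Summit.BirchSwinnertonDyer.Rank1Residual.Additive.GenusSeven

section Shape

variable (L : IntermediateField ℚ (AlgebraicClosure ℚ))

/-! ## §1 Units are closed under translates, integer powers and twisted products -/

/-- `u^k` (`k ∈ ℤ`) is an algebraic integer when `u` and `u⁻¹` are. [cite: Washington1997, §8.3] -/
theorem isIntegral_zpow_of_inv {u : L} (hu : IsIntegral ℤ u) (hu' : IsIntegral ℤ u⁻¹) (k : ℤ) : IsIntegral ℤ (u ^ k) := by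
  obtain ⟨n, rfl | rfl⟩ := Int.eq_nat_or_neg k
  · rw [zpow_natCast]; exact hu.pow n
  · rw [zpow_neg, zpow_natCast, ← inv_pow]; exact hu'.pow n

/-- `g u` and `(g u)⁻¹` are algebraic integers when `u`, `u⁻¹` are. [cite: Washington1997, §8.3] -/
theorem isIntegral_aut_of_inv {u : L} (hu : IsIntegral ℤ u) (hu' : IsIntegral ℤ u⁻¹) (g : L ≃ₐ[ℚ] L) :
    IsIntegral ℤ (g u) ∧ IsIntegral ℤ (g u)⁻¹ :=
  ⟨hu.map g.toAlgHom.toRingHom.toIntAlgHom, by rw [← map_inv₀]; exact hu'.map g.toAlgHom.toRingHom.toIntAlgHom⟩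

/-- The twisted product `∏ᶠ h, (h u)^{y h}` is an algebraic integer (`u`, `u⁻¹` integral). [cite: Washington1997, §8.3] -/
theorem isIntegral_finprod_aut_zpow [FiniteDimensional ℚ L] {u : L} (hu : IsIntegral ℤ u) (hu' : IsIntegral ℤ u⁻¹)
    (y : (L ≃ₐ[ℚ] L) → ℤ) : IsIntegral ℤ (∏ᶠ h : L ≃ₐ[ℚ] L, (h u) ^ (y h)) := by
  classical
  rw [finprod_eq_prod_of_fintype]
  exact IsIntegral.prod _ fun h _ =>
    isIntegral_zpow_of_inv L (isIntegral_aut_of_inv L hu hu' h).1 (isIntegral_aut_of_inv L hu hu' h).2 (y h)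

/-- … and so is its inverse (`= ∏ᶠ h, (h u)^{−y h}`). [cite: Washington1997, §8.3] -/
theorem isIntegral_finprod_aut_zpow_inv [FiniteDimensional ℚ L] {u : L} (hu : IsIntegral ℤ u) (hu' : IsIntegral ℤ u⁻¹)
    (y : (L ≃ₐ[ℚ] L) → ℤ) : IsIntegral ℤ (∏ᶠ h : L ≃ₐ[ℚ] L, (h u) ^ (y h))⁻¹ := by
  classical
  rw [finprod_eq_prod_of_fintype, ← Finset.prod_inv_distrib]
  refine IsIntegral.prod _ fun h _ => ?_
  rw [← zpow_neg]
  exact isIntegral_zpow_of_inv L (isIntegral_aut_of_inv L hu hu' h).1 (isIntegral_aut_of_inv L hu hu' h).2 (-y h)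

/-- The twisted product of a non-zero element is non-zero. [cite: Washington1997, §8.3] -/
theorem finprod_aut_zpow_ne_zero [FiniteDimensional ℚ L] {u : L} (hu : u ≠ 0) (y : (L ≃ₐ[ℚ] L) → ℤ) :
    (∏ᶠ h : L ≃ₐ[ℚ] L, (h u) ^ (y h)) ≠ 0 := by
  classical
  rw [finprod_eq_prod_of_fintype]
  exact Finset.prod_ne_zero_iff.mpr fun h _ => zpow_ne_zero _ ((map_ne_zero h).mpr hu)

/-! ## §2 The χ-logarithm of `V = U·c(U)` in closed form -/

/-- ★ **THE CLOSED FORM**: for `ξ♯ = ∏ᶠ h, (h ξ)^{y h}`, `U = ∏ᶠ g, (g (θ²·ξ♯))^{t g}`,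
`S_χ(U·c|_L U) = (Σ_g t_g·χ(g)⁻¹)·(1 + χ(c|_L)⁻¹)·(2·S_χ(θ) + (Σ_h y_h·χ(h)⁻¹)·S_χ(ξ))` (`θ, ξ ≠ 0`).
[cite: Washington1997, §8.3] [cite: Lang1990, Ch. 3 §5 (PDF p. 71)] -/
theorem logSum_twistedUnit [Normal ℚ L] [FiniteDimensional ℚ L] (Φ : AlgebraicClosure ℚ →+* ℂ) (χ : (L ≃ₐ[ℚ] L) →* ℂˣ)
    (c : AlgebraicClosure ℚ ≃ₐ[ℚ] AlgebraicClosure ℚ) {θ ξ : L} (hθ : θ ≠ 0) (hξ : ξ ≠ 0) (t y : (L ≃ₐ[ℚ] L) → ℤ) :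
    ∑ᶠ g : L ≃ₐ[ℚ] L, ((χ g : ℂˣ) : ℂ) *
        (Real.log ‖Φ (((g ((∏ᶠ g' : L ≃ₐ[ℚ] L, (g' (θ ^ 2 * ∏ᶠ h : L ≃ₐ[ℚ] L, (h ξ) ^ (y h))) ^ (t g')) *
          c.restrictNormal L (∏ᶠ g' : L ≃ₐ[ℚ] L, (g' (θ ^ 2 * ∏ᶠ h : L ≃ₐ[ℚ] L, (h ξ) ^ (y h))) ^ (t g'))) : L)) :
            AlgebraicClosure ℚ)‖ : ℂ) =
      (∑ᶠ g : L ≃ₐ[ℚ] L, (t g : ℂ) * ((χ g : ℂˣ) : ℂ)⁻¹) * (1 + ((χ (c.restrictNormal L) : ℂˣ) : ℂ)⁻¹) *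
        (2 * ∑ᶠ g : L ≃ₐ[ℚ] L, ((χ g : ℂˣ) : ℂ) * (Real.log ‖Φ (((g θ : L)) : AlgebraicClosure ℚ)‖ : ℂ) +
          (∑ᶠ h : L ≃ₐ[ℚ] L, (y h : ℂ) * ((χ h : ℂˣ) : ℂ)⁻¹) *
            ∑ᶠ g : L ≃ₐ[ℚ] L, ((χ g : ℂˣ) : ℂ) * (Real.log ‖Φ (((g ξ : L)) : AlgebraicClosure ℚ)‖ : ℂ)) := by
  have hξs : (∏ᶠ h : L ≃ₐ[ℚ] L, (h ξ) ^ (y h)) ≠ 0 := finprod_aut_zpow_ne_zero L hξ y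
  have hw : θ ^ 2 * ∏ᶠ h : L ≃ₐ[ℚ] L, (h ξ) ^ (y h) ≠ 0 := mul_ne_zero (pow_ne_zero _ hθ) hξs
  have hU : (∏ᶠ g' : L ≃ₐ[ℚ] L, (g' (θ ^ 2 * ∏ᶠ h : L ≃ₐ[ℚ] L, (h ξ) ^ (y h))) ^ (t g')) ≠ 0 :=
    finprod_aut_zpow_ne_zero L hw t
  have hcU : c.restrictNormal L (∏ᶠ g' : L ≃ₐ[ℚ] L, (g' (θ ^ 2 * ∏ᶠ h : L ≃ₐ[ℚ] L, (h ξ) ^ (y h))) ^ (t g')) ≠ 0 :=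
    (map_ne_zero _).mpr hU
  rw [logSum_mul L Φ χ hU hcU, logSum_translate, logSum_finprod_translate_zpow L Φ χ hw t,
    logSum_mul L Φ χ (pow_ne_zero _ hθ) hξs, logSum_pow, logSum_finprod_translate_zpow L Φ χ hξ y]
  push_cast
  ring

/-! ## §3 The exact identity reduced to one scalar per even character -/

/-- `χ(c|_L)² = 1` (`c² = 1`, B2b `complexConjugation_mul_self`). [cite: Washington1997, §8.3] -/
theorem character_restrictNormal_conj_sq [Normal ℚ L] {Φ : AlgebraicClosure ℚ →+* ℂ} (χ : (L ≃ₐ[ℚ] L) →* ℂˣ)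
    {c : AlgebraicClosure ℚ ≃ₐ[ℚ] AlgebraicClosure ℚ} (hc : ∀ x : AlgebraicClosure ℚ, Φ (c x) = conj (Φ x)) :
    χ (c.restrictNormal L) ^ 2 = 1 := by
  have hrN : ∀ σ : AlgebraicClosure ℚ ≃ₐ[ℚ] AlgebraicClosure ℚ, AlgEquiv.restrictNormalHom L σ = σ.restrictNormal L :=
    fun σ => rfl
  rw [sq, ← map_mul, ← hrN, ← map_mul, complexConjugation_mul_self hc, map_one, map_one]

/-- If `χ(c|_L) ≠ 1` then `1 + χ(c|_L)⁻¹ = 0` (`χ(c|_L) = −1`). [cite: Washington1997, §8.3] -/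
theorem one_add_inv_eq_zero_of_ne_one [Normal ℚ L] {Φ : AlgebraicClosure ℚ →+* ℂ} (χ : (L ≃ₐ[ℚ] L) →* ℂˣ)
    {c : AlgebraicClosure ℚ ≃ₐ[ℚ] AlgebraicClosure ℚ} (hc : ∀ x : AlgebraicClosure ℚ, Φ (c x) = conj (Φ x))
    (hχc : χ (c.restrictNormal L) ≠ 1) : 1 + ((χ (c.restrictNormal L) : ℂˣ) : ℂ)⁻¹ = 0 := by
  have hsq : (((χ (c.restrictNormal L) : ℂˣ) : ℂ)) ^ 2 = 1 := by
    rw [← Units.val_pow_eq_pow_val, character_restrictNormal_conj_sq L χ hc, Units.val_one]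
  have hne : ((χ (c.restrictNormal L) : ℂˣ) : ℂ) ≠ 1 := by
    rw [Ne, Units.val_eq_one]; exact hχc
  have hm1 : ((χ (c.restrictNormal L) : ℂˣ) : ℂ) = -1 := (sq_eq_one_iff.mp hsq).resolve_left hne
  rw [hm1]; norm_num

/-- ★★ **THE EXACT IDENTITY, REDUCED**: with the data of §2, `θ, ξ` units of `𝓞 L` (integral with integral inverse),
`Gal(L/ℚ)` commutative and `Φ ∘ c = conj ∘ Φ`: if for EVERY character `χ` with `χ(c|_L) = 1`
`(Σ_g t_g·χ(g)⁻¹)·(2·S_χ(θ) + (Σ_h y_h·χ(h)⁻¹)·S_χ(ξ)) = 0`, then `U·c|_L(U) = 1` EXACTLY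
(the odd `χ` are killed by `1 + χ(c|_L)⁻¹ = 0`; then C1 ★).  The successor's C2b is this hypothesis for the genus exponents.
[cite: Washington1997, Lemma 1.6 and §8.3] [cite: Lang1990, Ch. 3 §5 (PDF p. 71)] [cite: Tsuji1999, §6 (p. 20)] -/
theorem twistedUnit_eq_one_of_forall_even [Normal ℚ L] [FiniteDimensional ℚ L] (hcomm : ∀ a b : L ≃ₐ[ℚ] L, a * b = b * a)
    (Φ : AlgebraicClosure ℚ →+* ℂ) {c : AlgebraicClosure ℚ ≃ₐ[ℚ] AlgebraicClosure ℚ}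
    (hc : ∀ x : AlgebraicClosure ℚ, Φ (c x) = conj (Φ x)) {θ ξ : L}
    (hθi : IsIntegral ℤ θ) (hθi' : IsIntegral ℤ θ⁻¹) (hξi : IsIntegral ℤ ξ) (hξi' : IsIntegral ℤ ξ⁻¹) (hθ : θ ≠ 0) (hξ : ξ ≠ 0)
    (t y : (L ≃ₐ[ℚ] L) → ℤ)
    (hvan : ∀ χ : (L ≃ₐ[ℚ] L) →* ℂˣ, χ (c.restrictNormal L) = 1 →
      (∑ᶠ g : L ≃ₐ[ℚ] L, (t g : ℂ) * ((χ g : ℂˣ) : ℂ)⁻¹) *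
        (2 * ∑ᶠ g : L ≃ₐ[ℚ] L, ((χ g : ℂˣ) : ℂ) * (Real.log ‖Φ (((g θ : L)) : AlgebraicClosure ℚ)‖ : ℂ) +
          (∑ᶠ h : L ≃ₐ[ℚ] L, (y h : ℂ) * ((χ h : ℂˣ) : ℂ)⁻¹) *
            ∑ᶠ g : L ≃ₐ[ℚ] L, ((χ g : ℂˣ) : ℂ) * (Real.log ‖Φ (((g ξ : L)) : AlgebraicClosure ℚ)‖ : ℂ)) = 0) :
    (∏ᶠ g' : L ≃ₐ[ℚ] L, (g' (θ ^ 2 * ∏ᶠ h : L ≃ₐ[ℚ] L, (h ξ) ^ (y h))) ^ (t g')) *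
        c.restrictNormal L (∏ᶠ g' : L ≃ₐ[ℚ] L, (g' (θ ^ 2 * ∏ᶠ h : L ≃ₐ[ℚ] L, (h ξ) ^ (y h))) ^ (t g')) = 1 := by
  -- the unit `w = θ²·ξ♯` and `U`
  have hξs := isIntegral_finprod_aut_zpow L hξi hξi' y
  have hξs' := isIntegral_finprod_aut_zpow_inv L hξi hξi' y
  have hwi : IsIntegral ℤ (θ ^ 2 * ∏ᶠ h : L ≃ₐ[ℚ] L, (h ξ) ^ (y h)) := (hθi.pow 2).mul hξs
  have hwi' : IsIntegral ℤ (θ ^ 2 * ∏ᶠ h : L ≃ₐ[ℚ] L, (h ξ) ^ (y h))⁻¹ := by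
    rw [mul_inv, ← inv_pow]; exact (hθi'.pow 2).mul hξs'
  have hw : θ ^ 2 * ∏ᶠ h : L ≃ₐ[ℚ] L, (h ξ) ^ (y h) ≠ 0 := mul_ne_zero (pow_ne_zero _ hθ) (finprod_aut_zpow_ne_zero L hξ y)
  have hUi := isIntegral_finprod_aut_zpow L hwi hwi' t
  have hU0 := finprod_aut_zpow_ne_zero L hw t
  refine eq_one_of_forall_character_logSum_eq_zero L hcomm Φ hc hU0 hUi
    (by rw [MulMemClass.coe_mul, coe_restrictNormal_apply]) fun χ => ?_
  rw [logSum_twistedUnit L Φ χ c hθ hξ t y]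
  by_cases hχc : χ (c.restrictNormal L) = 1
  · have h := hvan χ hχc
    linear_combination (1 + ((χ (c.restrictNormal L) : ℂˣ) : ℂ)⁻¹) * h
  · rw [one_add_inv_eq_zero_of_ne_one L χ hc hχc, mul_zero, zero_mul]

end Shape

end Summit.BirchSwinnertonDyer.Rank1Residual.Additive.GenusSeven

end
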